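import Summits.NavierStokesRegularity.FluidComputer.CrossingLadder
import HarnessLib

/-!
# Fluid computer — the PURE-DELAY family of the `√ν·Z` crossing test (clock side of idea-2's P98, §3 of
# the `CrossingLadder` dictionary; pub-fluidc-lit gen 41)

HONEST FRAMING (cell `pub-fluidc`, verbatim): *low prior, high value-of-information experiment on Tao's
machine paradigm; NOT a claim that NS blows up.*  Theorem side of the cell; pure real bookkeeping, 0 sorry,
no definition, no named fact (D-0026).

WHY THIS FAMILY.  Cell LITERATURE.md §A22.23c: the two printed reconnection pictures SHARE the
amplitude law (`√ν Z` reaches a `ν`-independent level — `EnstrophyCrossing.dissipation_powerlaw_iff`) and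
differ on the CLOCK; with the levels pinned, the residual freedom between two rungs' `B`-curves near the
event is a time shift, and this leaf types that residual mechanism in isolation.

The clock-shift mechanism in isolation: curves `t ↦ Z(t − τ)` for ONE unimodal template `Z` (strictly
increasing on `(-∞, P]`, strictly decreasing on `[P, ∞)`; the member with delay `τ` peaks at `P + τ`).
Two members `τ₁ < τ₂` cross EXACTLY ONCE, at a time STRICTLY BETWEEN THEIR PEAK TIMES
`P + τ₁ < x < P + τ₂` (`delay_crossing_mem_Ioo`, `delay_crossing_exists`, `delay_crossing_unique`), with
the more delayed member below before and above after (`delay_lt_before_crossing`,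
`delay_gt_after_crossing` — exactly the single-crossing pattern `CrossingLadder` §1 assumes); three members
fan out strictly in the order of the delays with the skip pair strictly inside (`delay_fanout`, via
`CrossingLadder.skip_crossing_mem_Ioo`), so a delay family is never KERR-COMMON (`delay_crossings_ne`); equi-spaced delays give crossings
in arithmetic progression at ONE common level (`delay_equispaced_crossings`), every crossing level lying
below the common peak value (`delay_crossing_lt_peak`).

Reading (information for the rung line, no claim about any paper's model): a pairwise crossing observed
AT OR BEFORE the earlier of the two peak times is not carried by a delay clock
(`delay_no_crossing_before_peak`); on the cell's anchor pair (cell STATUS l.4190, PREREG §2h) the `√νZ`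
crossing `t_x(1,√2) = 2.25` precedes both enstrophy peaks `t_Z = 2.79 (ρ1) < 3.24 (ρ√2)`, so whatever fans
or pins the ladder's crossing times there, it is not a rigid time shift of one curve — compare the
amplitude-exponent family of `EnstrophyCrossing` §3, whose crossings sit where the exponent passes `1/2`,
unconstrained by the peaks.
-/

noncomputable section

namespace Summit.NavierStokesRegularity.FluidComputer.CrossingDelay

open Set Real Summit.NavierStokesRegularity.FluidComputer.CrossingLadder

section Delay

variable {Z : ℝ → ℝ} {P τ₁ τ₂ τ₃ x y t : ℝ}

/-! Template `Z` unimodal with peak time `P`: `StrictMonoOn Z (Iic P)` and `StrictAntiOn Z (Ici P)`;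
member with delay `τ` is `t ↦ Z (t - τ)`, peaking at `P + τ`. -/

/-- Up to the EARLIER peak time the more delayed member is strictly below. -/
theorem delay_lt_before_peak (hup : StrictMonoOn Z (Iic P)) (hτ : τ₁ < τ₂) (ht : t ≤ P + τ₁) :
    Z (t - τ₂) < Z (t - τ₁) :=
  hup (mem_Iic.2 (by linarith)) (mem_Iic.2 (by linarith)) (by linarith)

/-- From the LATER peak time on the more delayed member is strictly above. -/
theorem delay_gt_after_peak (hdn : StrictAntiOn Z (Ici P)) (hτ : τ₁ < τ₂) (ht : P + τ₂ ≤ t) :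
    Z (t - τ₁) < Z (t - τ₂) :=
  hdn (mem_Ici.2 (by linarith)) (mem_Ici.2 (by linarith)) (by linarith)

/-- **A crossing of two delayed copies lies STRICTLY BETWEEN their peak times.** -/
theorem delay_crossing_mem_Ioo (hup : StrictMonoOn Z (Iic P)) (hdn : StrictAntiOn Z (Ici P))
    (hτ : τ₁ < τ₂) (hx : Z (x - τ₁) = Z (x - τ₂)) : x ∈ Ioo (P + τ₁) (P + τ₂) := by
  constructor
  · by_contra h
    exact (delay_lt_before_peak hup hτ (not_lt.1 h)).ne' hx
  · by_contra h
    exact (delay_gt_after_peak hdn hτ (not_lt.1 h)).ne hx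

/-- Contrapositive used by the rung line: a crossing at or before the earlier peak time is impossible
for delayed copies. -/
theorem delay_no_crossing_before_peak (hup : StrictMonoOn Z (Iic P)) (hτ : τ₁ < τ₂)
    (hx : x ≤ P + τ₁) : Z (x - τ₁) ≠ Z (x - τ₂) :=
  (delay_lt_before_peak hup hτ hx).ne'

/-- Between the two peak times the difference `Z(t − τ₁) − Z(t − τ₂)` is strictly decreasing. -/
theorem delay_diff_strictAntiOn (hup : StrictMonoOn Z (Iic P)) (hdn : StrictAntiOn Z (Ici P)) :
    StrictAntiOn (fun t => Z (t - τ₁) - Z (t - τ₂)) (Icc (P + τ₁) (P + τ₂)) := by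
  intro s hs u hu hsu
  have h1 : Z (u - τ₁) < Z (s - τ₁) :=
    hdn (mem_Ici.2 (by linarith [hs.1])) (mem_Ici.2 (by linarith [hu.1])) (by linarith)
  have h2 : Z (s - τ₂) < Z (u - τ₂) :=
    hup (mem_Iic.2 (by linarith [hs.2])) (mem_Iic.2 (by linarith [hu.2])) (by linarith)
  show Z (u - τ₁) - Z (u - τ₂) < Z (s - τ₁) - Z (s - τ₂)
  linarith

/-- **Existence** (continuous template): two delayed copies with `τ₁ < τ₂` cross between their peaks. -/
theorem delay_crossing_exists (hZ : Continuous Z) (hup : StrictMonoOn Z (Iic P))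
    (hdn : StrictAntiOn Z (Ici P)) (hτ : τ₁ < τ₂) :
    ∃ x ∈ Ioo (P + τ₁) (P + τ₂), Z (x - τ₁) = Z (x - τ₂) := by
  have hg : ContinuousOn (fun t => Z (t - τ₁) - Z (t - τ₂)) (Icc (P + τ₁) (P + τ₂)) :=
    ((hZ.comp (continuous_id.sub continuous_const)).sub
      (hZ.comp (continuous_id.sub continuous_const))).continuousOn
  have h1 : 0 ≤ Z (P + τ₁ - τ₁) - Z (P + τ₁ - τ₂) :=
    (sub_pos.2 (delay_lt_before_peak hup hτ le_rfl)).le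
  have h2 : Z (P + τ₂ - τ₁) - Z (P + τ₂ - τ₂) ≤ 0 :=
    (sub_neg.2 (delay_gt_after_peak hdn hτ le_rfl)).le
  obtain ⟨x, hx, hx0⟩ := intermediate_value_Icc' (by linarith) hg ⟨h2, h1⟩
  have hx' : Z (x - τ₁) = Z (x - τ₂) := sub_eq_zero.1 hx0
  exact ⟨x, delay_crossing_mem_Ioo hup hdn hτ hx', hx'⟩

/-- **Uniqueness**: two delayed copies cross at most once. -/
theorem delay_crossing_unique (hup : StrictMonoOn Z (Iic P)) (hdn : StrictAntiOn Z (Ici P))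
    (hτ : τ₁ < τ₂) (hx : Z (x - τ₁) = Z (x - τ₂)) (hy : Z (y - τ₁) = Z (y - τ₂)) : x = y := by
  have hxI := Ioo_subset_Icc_self (delay_crossing_mem_Ioo hup hdn hτ hx)
  have hyI := Ioo_subset_Icc_self (delay_crossing_mem_Ioo hup hdn hτ hy)
  have hx0 : Z (x - τ₁) - Z (x - τ₂) = 0 := sub_eq_zero.2 hx
  have hy0 : Z (y - τ₁) - Z (y - τ₂) = 0 := sub_eq_zero.2 hy
  by_contra hne
  rcases lt_or_gt_of_ne hne with h | h
  · have := delay_diff_strictAntiOn hup hdn hxI hyI h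
    simp only [hx0, hy0, lt_irrefl] at this
  · have := delay_diff_strictAntiOn hup hdn hyI hxI h
    simp only [hx0, hy0, lt_irrefl] at this

/-- Sign pattern BEFORE the crossing (on all of `ℝ`): the more delayed member is below. -/
theorem delay_lt_before_crossing (hup : StrictMonoOn Z (Iic P)) (hdn : StrictAntiOn Z (Ici P))
    (hτ : τ₁ < τ₂) (hx : Z (x - τ₁) = Z (x - τ₂)) (ht : t < x) : Z (t - τ₂) < Z (t - τ₁) := by
  rcases le_or_gt t (P + τ₁) with h | h
  · exact delay_lt_before_peak hup hτ h
  · have hxI := delay_crossing_mem_Ioo hup hdn hτ hx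
    have := delay_diff_strictAntiOn hup hdn ⟨h.le, (ht.trans hxI.2).le⟩
      (Ioo_subset_Icc_self hxI) ht
    have hx0 : Z (x - τ₁) - Z (x - τ₂) = 0 := sub_eq_zero.2 hx
    simp only [hx0] at this
    linarith

/-- Sign pattern AFTER the crossing: the more delayed member is above. -/
theorem delay_gt_after_crossing (hup : StrictMonoOn Z (Iic P)) (hdn : StrictAntiOn Z (Ici P))
    (hτ : τ₁ < τ₂) (hx : Z (x - τ₁) = Z (x - τ₂)) (ht : x < t) : Z (t - τ₁) < Z (t - τ₂) := by
  rcases le_or_gt (P + τ₂) t with h | h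
  · exact delay_gt_after_peak hdn hτ h
  · have hxI := delay_crossing_mem_Ioo hup hdn hτ hx
    have := delay_diff_strictAntiOn hup hdn (Ioo_subset_Icc_self hxI)
      ⟨(hxI.1.trans ht).le, h.le⟩ ht
    have hx0 : Z (x - τ₁) - Z (x - τ₂) = 0 := sub_eq_zero.2 hx
    simp only [hx0] at this
    linarith

/-- **Strict FAN-OUT of a delay family.**  Three delayed copies `τ₁ < τ₂ < τ₃` with pairwise crossings
`x₁₂, x₂₃, x₁₃`: then `x₁₂ < x₁₃ < x₂₃` (the adjacent crossings are separated by the middle peak time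
`P + τ₂`, and §1 places the skip crossing strictly inside). -/
theorem delay_fanout (hup : StrictMonoOn Z (Iic P)) (hdn : StrictAntiOn Z (Ici P)) (h₁₂ : τ₁ < τ₂)
    (h₂₃ : τ₂ < τ₃) {x₁₂ x₂₃ x₁₃ : ℝ} (hx₁₂ : Z (x₁₂ - τ₁) = Z (x₁₂ - τ₂))
    (hx₂₃ : Z (x₂₃ - τ₂) = Z (x₂₃ - τ₃)) (hx₁₃ : Z (x₁₃ - τ₁) = Z (x₁₃ - τ₃)) :
    x₁₂ < x₁₃ ∧ x₁₃ < x₂₃ := by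
  have hlt : x₁₂ < x₂₃ :=
    (delay_crossing_mem_Ioo hup hdn h₁₂ hx₁₂).2.trans (delay_crossing_mem_Ioo hup hdn h₂₃ hx₂₃).1
  have key := skip_crossing_mem_Ioo (W := univ) (fa := fun t => Z (t - τ₁)) (fb := fun t => Z (t - τ₂))
    (fc := fun t => Z (t - τ₃))
    (fun t _ ht => delay_lt_before_crossing hup hdn h₁₂ hx₁₂ ht)
    (fun t _ ht => delay_gt_after_crossing hup hdn h₁₂ hx₁₂ ht)
    (fun t _ ht => delay_lt_before_crossing hup hdn h₂₃ hx₂₃ ht)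
    (fun t _ ht => delay_gt_after_crossing hup hdn h₂₃ hx₂₃ ht)
    (mem_univ _) (mem_univ _) hx₁₂ hx₂₃ hlt (mem_univ x₁₃) hx₁₃
  exact ⟨key.1, key.2⟩

/-- In particular a delay family is never KERR-COMMON: the two adjacent crossing times differ
(indeed `x₁₂ < P + τ₂ < x₂₃`). -/
theorem delay_crossings_ne (hup : StrictMonoOn Z (Iic P)) (hdn : StrictAntiOn Z (Ici P))
    (h₁₂ : τ₁ < τ₂) (h₂₃ : τ₂ < τ₃) {x₁₂ x₂₃ : ℝ} (hx₁₂ : Z (x₁₂ - τ₁) = Z (x₁₂ - τ₂))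
    (hx₂₃ : Z (x₂₃ - τ₂) = Z (x₂₃ - τ₃)) : x₁₂ < P + τ₂ ∧ P + τ₂ < x₂₃ :=
  ⟨(delay_crossing_mem_Ioo hup hdn h₁₂ hx₁₂).2, (delay_crossing_mem_Ioo hup hdn h₂₃ hx₂₃).1⟩

/-- Translation covariance: shifting both delays by `Δ` shifts every crossing by `Δ` and keeps its
level. -/
theorem delay_crossing_translate {Δ : ℝ} (hx : Z (x - τ₁) = Z (x - τ₂)) :
    Z (x + Δ - (τ₁ + Δ)) = Z (x + Δ - (τ₂ + Δ)) := by
  rw [show x + Δ - (τ₁ + Δ) = x - τ₁ by ring, show x + Δ - (τ₂ + Δ) = x - τ₂ by ring, hx]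

/-- **Equi-spaced delays ⇒ crossings in arithmetic progression at ONE level.**  If
`τ₂ − τ₁ = τ₃ − τ₂` then the `(2,3)` crossing is the `(1,2)` crossing shifted by `τ₂ − τ₁`, and the two
crossing values coincide.  (So in a delay family whose delays are equi-spaced along the ladder the
adjacent crossing LEVELS are equal; a crossing level that rises from one adjacent pair to the next is not
of this form.) -/
theorem delay_equispaced_crossings (hup : StrictMonoOn Z (Iic P)) (hdn : StrictAntiOn Z (Ici P))
    (h₁₂ : τ₁ < τ₂) (hgap : τ₂ - τ₁ = τ₃ - τ₂) {x₁₂ x₂₃ : ℝ} (hx₁₂ : Z (x₁₂ - τ₁) = Z (x₁₂ - τ₂))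
    (hx₂₃ : Z (x₂₃ - τ₂) = Z (x₂₃ - τ₃)) :
    x₂₃ = x₁₂ + (τ₂ - τ₁) ∧ Z (x₂₃ - τ₂) = Z (x₁₂ - τ₁) := by
  have h₂₃ : τ₂ < τ₃ := by linarith
  have hshift : Z (x₁₂ + (τ₂ - τ₁) - τ₂) = Z (x₁₂ + (τ₂ - τ₁) - τ₃) := by
    rw [show x₁₂ + (τ₂ - τ₁) - τ₂ = x₁₂ - τ₁ by ring,
      show x₁₂ + (τ₂ - τ₁) - τ₃ = x₁₂ - τ₂ by linarith, hx₁₂]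
  have hx : x₂₃ = x₁₂ + (τ₂ - τ₁) := delay_crossing_unique hup hdn h₂₃ hx₂₃ hshift
  refine ⟨hx, ?_⟩
  rw [hx, show x₁₂ + (τ₂ - τ₁) - τ₂ = x₁₂ - τ₁ by ring]

/-- The crossing level of two delayed copies is strictly below the common peak value `Z P`. -/
theorem delay_crossing_lt_peak (hup : StrictMonoOn Z (Iic P)) (hdn : StrictAntiOn Z (Ici P))
    (hτ : τ₁ < τ₂) (hx : Z (x - τ₁) = Z (x - τ₂)) : Z (x - τ₁) < Z P := by
  have hxI := delay_crossing_mem_Ioo hup hdn hτ hx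
  rw [hx]
  have h : x - τ₂ < P := by linarith [hxI.2]
  exact hup (mem_Iic.2 h.le) (mem_Iic.2 le_rfl) h

end Delay

end Summit.NavierStokesRegularity.FluidComputer.CrossingDelay

end
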